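import Mathlib
import Literature.AlgebraicGeometry.Resolution.SolvableVertexTransport
import Literature.AlgebraicGeometry.Resolution.CurveBlowupPolygonLaws
import HarnessLib

/-!
# Solvable vertices under the blowing up of a curve

Topic: `Literature/AlgebraicGeometry/Resolution`. Cossart–Jannsen–Saito, LNM 2270,
Lemma 12.4 (3): "If `(f, y, u)` is `v`-prepared (resp. `δ`-prepared, resp. totally prepared), so
is `(f′, y′, u)`" for the blowing up along `V(y, u₁)` (Cossart–Piltant 2008, Lemma 4.5 (1):
"`Δ(E′; u₁, u₂; z′)` remains prepared"). In the language of `IsSolvableAt` we PROVE the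
contrapositive transport (no facts):

* `mem_weightedIdealW_of_map_mem_curve` — **contraction** for the curve chart
  (`φ f ∈ F′^{(W′)}_ρ ⇒ f ∈ F^{(W)}_ρ`, `W = (W′₀ + W′₁, W′₁, W′₂)`), by transporting an initial
  unit term and weighted quasi-regularity of `R′`;
* `isSolvableAt_of_curveChart` — if the weak transform `J′ = (J R′ : u₁^μ)` of `J ⊆ (y, u₁)^μ`
  is solvable at `(v₁ − 1, v₂)` (`v₁ ≥ 1`) along the positive weight `W′`, then `J` is solvable
  at `(v₁, v₂)` along `W` (residue map surjective).

## Sources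

* V. Cossart, U. Jannsen, S. Saito, LNM 2270 (2020), Lemma 12.4 (3). [CossartJannsenSaito2020]
* V. Cossart, O. Piltant, J. Algebra 320 (2008), Lemma 4.5 (1). [CossartPiltant2008]
-/

noncomputable section

open IsLocalRing MvPolynomial

namespace Literature.AlgebraicGeometry.Resolution

universe u

section CurveChart

variable {R R' : Type u} [CommRing R] [CommRing R'] (φ : R →+* R') {c : Fin 3 → R}
  {c' : Fin 3 → R'} (h₁ : c' 1 = φ (c 1)) (h₀ : φ (c 0) = φ (c 1) * c' 0)
  (h₂ : c' 2 = φ (c 2)) (W' : Fin 3 → ℕ)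

include h₁ h₂ in
/-- The shift monomial goes up: `φ u₁ · c′^{vexp (v₁ − 1) v₂} = φ(c^{vexp v₁ v₂})` when `v₁ ≥ 1`.
[folklore] -/
theorem map_monom3_vexp_curve {v₁ v₂ : ℕ} (hv : 1 ≤ v₁) :
    φ (c 1) * monom3 c' (vexp (v₁ - 1) v₂) = φ (monom3 c (vexp v₁ v₂)) := by
  rw [monom3_vexp, monom3_vexp, map_mul, map_pow, map_pow, h₂, h₁]
  obtain ⟨k, hk⟩ : ∃ k, v₁ = k + 1 := ⟨v₁ - 1, by omega⟩
  have : v₁ - 1 = k := by omega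
  rw [this, hk, pow_succ]; ring

variable [IsRegularLocalRing R] [IsRegularLocalRing R']
  (hgen : Ideal.span {c 0, c 1, c 2} = maximalIdeal R) (hdim : ringKrullDim R = 3)
  (hgen' : Ideal.span {c' 0, c' 1, c' 2} = maximalIdeal R') (hdim' : ringKrullDim R' = 3)
  (hW' : ∀ i, 0 < W' i)

include h₁ h₀ h₂ hgen hdim hgen' hdim' hW' in
/-- **Contraction for the curve chart**: `φ f ∈ F′^{(W′)}_ρ ⇒ f ∈ F^{(W)}_ρ` for the pulled-back
weight `W = (W′₀ + W′₁, W′₁, W′₂)` (transport of an initial unit term of `f` and weighted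
quasi-regularity of `R′`). [cite: CossartJannsenSaito2020, Lemma 12.4] [cite: CossartPiltant2008, Lemma 4.5 (1)] -/
theorem mem_weightedIdealW_of_map_mem_curve {ρ : ℕ} {f : R}
    (hf : φ f ∈ weightedIdealW c' W' ρ) : f ∈ weightedIdealW c (curvePullbackWeight W') ρ := by
  classical
  have hW : ∀ i, 0 < curvePullbackWeight W' i := by
    intro i
    fin_cases i
    · change 0 < W' 0 + W' 1; have := hW' 0; omega
    · exact hW' 1
    · exact hW' 2
  refine (mem_weightedIdealW_iff_forall_isInitialTerm c hgen hdim hW f ρ).mpr fun e he => ?_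
  by_contra hlt
  push Not at hlt
  obtain ⟨F, hF, hFu, hFrem⟩ := he
  -- transport `F`
  set G : MvPolynomial (Fin 3) R' := ∑ m ∈ F.support, monomial (curveExp m) (φ (F.coeff m)) with hG
  have hGcoeff : ∀ m ∈ F.support, G.coeff (curveExp m) = φ (F.coeff m) := by
    intro m hm
    rw [hG, coeff_sum, Finset.sum_eq_single m]
    · rw [coeff_monomial, if_pos rfl]
    · intro m' _ hne
      rw [coeff_monomial, if_neg]
      exact fun h' => hne (curveExp_injective h')
    · intro hm'; exact absurd hm hm'
  have hGsupp : ∀ n ∈ G.support, ∃ m ∈ F.support, n = curveExp m := by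
    intro n hn
    rw [hG] at hn
    obtain ⟨m, hm, hmn⟩ := Finset.mem_biUnion.mp (support_sum hn)
    exact ⟨m, hm, Finset.mem_singleton.mp (support_monomial_subset hmn)⟩
  have hGhom : G.IsWeightedHomogeneous W' (Finsupp.weight (curvePullbackWeight W') e) := by
    intro n hn
    obtain ⟨m, hm, rfl⟩ := hGsupp n (mem_support_iff.mpr hn)
    rw [weight_curveExp]
    exact hF (mem_support_iff.mp hm)
  have hGeval : eval c' G = φ (eval c F) := by
    conv_rhs => rw [F.as_sum, map_sum, map_sum]
    rw [hG, map_sum]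
    refine Finset.sum_congr rfl fun m _ => ?_
    rw [eval_monomial_eq_monom3, eval_monomial_eq_monom3, map_mul, map_monom3_curveChart φ h₁ h₀ h₂]
  have heG : e ∈ F.support := mem_support_iff.mpr hFu.ne_zero
  have hGe : IsUnit (G.coeff (curveExp e)) := by rw [hGcoeff e heG]; exact hFu.map φ
  -- `G(c′) = φ f − φ (f − F(c)) ∈ F′_{n+1}`
  have hmem : eval c' G ∈ weightedIdealW c' W' (Finsupp.weight (curvePullbackWeight W') e + 1) := by
    rw [hGeval]
    have h1 : φ f ∈ weightedIdealW c' W' (Finsupp.weight (curvePullbackWeight W') e + 1) :=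
      weightedIdealW_antitone c' W' hlt hf
    have h2 : φ (f - eval c F) ∈ weightedIdealW c' W' (Finsupp.weight (curvePullbackWeight W') e + 1) :=
      map_weightedIdealW_le_curve φ h₁ h₀ h₂ W' _ (Ideal.mem_map_of_mem _ hFrem)
    have : φ (eval c F) = φ f - φ (f - eval c F) := by rw [map_sub]; ring
    rw [this]; exact Ideal.sub_mem _ h1 h2
  exact eval_not_mem_of_isUnit_coeff c' hgen' hdim' hW' hGhom hGe hmem

include h₁ h₀ h₂ hgen hdim hgen' hdim' hW' in
/-- **Solvability descends through the curve chart** (CJS Lemma 12.4 (3), contrapositive form):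
with `W` the pull-back of the positive weight `W′` and `n = μ W₀ = μ W′₀ + μ W′₁`: if the residue
map is surjective and the weak transform `J′ = (J R′ : (φ u₁)^μ)` of `J ⊆ (y, u₁)^μ` is solvable at
`vexp (v₁ − 1) v₂` (`v₁ ≥ 1`) along `W′` in degree `μ W′₀`, then `J` is solvable at `vexp v₁ v₂`
along `W` in degree `μ W₀`. [cite: CossartJannsenSaito2020, Lemma 12.4 (3)] [cite: CossartPiltant2008, Lemma 4.5 (1)] -/
theorem isSolvableAt_of_curveChart [IsLocalHom φ] (hψ : Function.Surjective (ResidueField.map φ))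
    {J : Ideal R} {μ : ℕ} (hJμ : J ≤ Ideal.span {c 0, c 1} ^ μ) {v₁ v₂ : ℕ} (hv : 1 ≤ v₁)
    (hvW : Finsupp.weight (curvePullbackWeight W') (vexp v₁ v₂) = curvePullbackWeight W' 0)
    {lam : R}
    (hsolv' : IsSolvableAt c' ((J.map φ).colon {φ (c 1) ^ μ}) W' (μ * W' 0) μ
      (vexp (v₁ - 1) v₂) (residue R' (φ lam))) :
    IsSolvableAt c J (curvePullbackWeight W') (μ * curvePullbackWeight W' 0) μ (vexp v₁ v₂)
      (residue R lam) := by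
  have hW : ∀ i, 0 < curvePullbackWeight W' i := by
    intro i
    fin_cases i
    · change 0 < W' 0 + W' 1; have := hW' 0; omega
    · exact hW' 1
    · exact hW' 2
  have hgenr' := span_range_eq_of_span_triple c' hgen'
  refine isSolvableAt_of_forall_exists_sub_mem c hgen hdim hW rfl (by simp) hvW fun f hfJ hfn => ?_
  obtain ⟨g, hg⟩ := exists_eq_pow_mul_of_mem_pPow φ h₀ (hJμ hfJ)
  have hgJ' : g ∈ (J.map φ).colon {φ (c 1) ^ μ} := by
    rw [Submodule.mem_colon_singleton, smul_eq_mul, mul_comm, ← hg]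
    exact Ideal.mem_map_of_mem _ hfJ
  have hlev : μ * curvePullbackWeight W' 0 = μ * W' 0 + μ * W' 1 := by
    change μ * (W' 0 + W' 1) = _; ring
  have hgn : g ∈ weightedIdealW c' W' (μ * W' 0) := by
    refine colon_le_weightedIdealW_of_le_curve φ h₁ h₀ h₂ W' hgen' hdim' hW'
      (J := Ideal.span {f}) (μ := μ) (ρ' := μ * W' 0) ?_ ?_
    · rw [Ideal.span_le, Set.singleton_subset_iff, ← hlev]; exact hfn
    · rw [Submodule.mem_colon_singleton, smul_eq_mul, mul_comm, ← hg]
      exact Ideal.mem_map_of_mem _ (Ideal.subset_span rfl)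
  obtain ⟨a', ha'⟩ := IsSolvableAt.exists_sub_mem c' hgen' hdim' hW' rfl hsolv' hgJ' hgn
  obtain ⟨abar, habar⟩ := hψ (residue R' a')
  obtain ⟨a, ha⟩ := residue_surjective (R := R) abar
  have haa' : a' - φ a ∈ maximalIdeal R' := by
    rw [← residue_eq_zero_iff, map_sub, ← habar, ← ha, ResidueField.map_residue, sub_self]
  refine ⟨a, ?_⟩
  have hpow : φ (c 1) ^ μ * (c' 0 + φ lam * monom3 c' (vexp (v₁ - 1) v₂)) ^ μ =
      φ ((c 0 + lam * monom3 c (vexp v₁ v₂)) ^ μ) := by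
    rw [← mul_pow, map_pow, mul_add, ← h₀, map_add, map_mul, ← map_monom3_vexp_curve φ h₁ h₂ hv]
    ring
  refine mem_weightedIdealW_of_map_mem_curve φ h₁ h₀ h₂ W' hgen hdim hgen' hdim' hW' ?_
  have hsplit : φ (f - a * (c 0 + lam * monom3 c (vexp v₁ v₂)) ^ μ) =
      φ (c 1) ^ μ * (g - a' * (c' 0 + φ lam * monom3 c' (vexp (v₁ - 1) v₂)) ^ μ) +
        (a' - φ a) * (φ (c 1) ^ μ * (c' 0 + φ lam * monom3 c' (vexp (v₁ - 1) v₂)) ^ μ) := by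
    rw [map_sub, map_mul, hg, ← hpow]; ring
  rw [hsplit, hlev]
  refine Ideal.add_mem _ ?_ ?_
  · have hmon : φ (c 1) ^ μ ∈ weightedIdealW c' W' (μ * W' 1) := by
      have : φ (c 1) ^ μ = monom3 c' (Finsupp.single 1 μ) := by simp [monom3, h₁]
      rw [this]
      refine monomial_mem_weightedIdealW c' W' ?_
      rw [Finsupp.weight_apply, Finsupp.sum_single_index (by simp), smul_eq_mul]
    have := weightedIdealW_mul_le c' W' _ _ (Ideal.mul_mem_mul hmon ha')
    refine weightedIdealW_antitone c' W' ?_ this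
    omega
  · have hmem : φ (c 1) ^ μ * (c' 0 + φ lam * monom3 c' (vexp (v₁ - 1) v₂)) ^ μ ∈
        weightedIdealW c' W' (μ * W' 0 + μ * W' 1) := by
      rw [hpow, ← hlev]
      refine map_weightedIdealW_le_curve φ h₁ h₀ h₂ W' _ (Ideal.mem_map_of_mem _ ?_)
      have hbase : c 0 + lam * monom3 c (vexp v₁ v₂) ∈
          weightedIdealW c (curvePullbackWeight W') (curvePullbackWeight W' 0) :=
        Ideal.add_mem _ (apply_mem_weightedIdealW c _ 0)
          (Ideal.mul_mem_left _ _ (monomial_mem_weightedIdealW c _ hvW.ge))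
      exact pow_mem_weightedIdealW c _ hbase μ
    exact maximalIdeal_mul_weightedIdealW_le c' W' hW' hgenr' _ (Ideal.mul_mem_mul haa' hmem)

end CurveChart

end Literature.AlgebraicGeometry.Resolution
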